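import Mathlib
import HarnessLib
import Summits.HubbardSuperconductivity.HubbardSuperconductivity.Theorems.KLProgrammeKLRegimeEnginePairTransferMemberPHSignedRow
import Summits.HubbardSuperconductivity.HubbardSuperconductivity.Theorems.KLProgrammeKLRegimeSplitThermalLayer

/-!
# Route `KLProgramme` — ENGINE item stmt-HubbardSuperconductivity-20437 `KLRegimeEngineV17F2`, class-#5 STEP (X).3 rows form: THE SIGNED MEMBER ROW IN
# THE STEP'S NORMALISATION — `(Λₙ − Λₙ₊₁)·klmsRowBound = (3/2π)·[ZS₀·Λₙ₊₁ + TH₀·(π/β)/Λₙ₊₁ + TR₀·δ/Λₙ₊₁] + LAT₀/L`, i.e. the ROOM's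
# `(4ⁿ⁺¹)⁻¹`-type, `3·thermalBar`-type, `|q|/Λₙ₊₁` and `1/L` slots, and the thermal dictionary `(π/β)/Λₙ₊₁ ≤ 4·4^{−(n_β−n)}`
# (cell gate-hubbard-kl, seat hubbard-kl-k3c2-p2 g17, technique «thermal-bar induction n ≤ nScales β + 1»)

The ξᵢ door multiplies `RP + RQ + 2RS` by `(Λₙ − Λₙ₊₁)((βL²)³)⁻¹`; `klms_memberPH_direct_signed_le` bounds `RP` by `(βL²)³·(klmsRowBound(δ⁺) + klmsRowBound(δ⁻)) + ε·flat`.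
This file reads `(Λₙ − Λₙ₊₁)·klmsRowBound d A G A₀ L_A β n j δ L` EXACTLY as a sum of four slot-shaped monomials (`klmsRowBound_reading`, pure algebra; `Λₙ = 4Λₙ₊₁`):
`ZS₀`, `TH₀`, `TR₀` are `Λ`-free closed constants in `(d − 4A, A, A₀, L_A, (Λₙ₊₁/Λ_j)², B₂)`, `LAT₀ = 96·(512·L_A/Λₙ₊₁ + 32·A₀·G·c/Λₙ₊₁²)`; and books the thermal
monomial on the ladder: `(π/β)/Λₙ₊₁ ≤ 4·4^{−(n_β − n)}` for `n ≤ n_β` (`klmsRoom_thermal_le`, from `klth_ratio_le_inv_pow`-type dictionary of …ThermalLayer), the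
flat remainder in the door's normalisation `(Λₙ − Λₙ₊₁)((βL²)³)⁻¹·(ε·(512/3)(βL²)²/Λ(t)²·Σ|Φ|‖ĝ‖) ≤ ε·2048·klSoftMass n Φ_j(t)` is `direct_row_flat_le`'s arithmetic
(`klmsRoom_flat_le`).  Pure real arithmetic; nothing about the model is asserted.
-/

noncomputable section

namespace Summit.HubbardSuperconductivity.HubbardSuperconductivity.Theorems.KLRegimeSplit

set_option linter.dupNamespace false -- summit = problem name (single-conjunct summit), D-0017

open Real Literature.MathematicalPhysics.QuantumLattice Literature.Probability.LatticeModels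
open Summit.HubbardSuperconductivity.HubbardSuperconductivity.Theorems.KLProgrammeLegKernels

/-- **EXACT READING of the signed member row in the STEP's normalisation** (`Λₙ − Λₙ₊₁ = 3Λₙ₊₁`):
`(Λₙ − Λₙ₊₁)·klmsRowBound = (3/(2π))·(ZS₀·Λₙ₊₁ + TH₀·((π/β)/Λₙ₊₁) + TR₀·((|0| + δ)/Λₙ₊₁)) + LAT₀/L`. -/
theorem klmsRowBound_reading (d A G A₀ La β : ℝ) (n j : ℕ) (δ : ℝ) (L : ℕ) [NeZero L] :
    (klScale klE0 n - klScale klE0 (n + 1)) * klmsRowBound d A G A₀ La β n j δ L =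
      3 / (2 * π) *
          ((524288 / Real.pi * (64 * (klScale klE0 (n + 1) / klScale klE0 j) ^ 2 + (2 * (448 / 3 * Real.exp 2) + 8) + 64) *
                (Real.pi * Real.sqrt 2 / (d - 4 * A) * (2 * La + 2 * A₀ * (2 / (1 / 10))) / (d - 4 * A) +
                  2 * A₀ * (1 / (d - 4 * A) ^ 2 + Real.pi * Real.sqrt 2 * (2 + 4 * A) / (d - 4 * A) ^ 3))) *
              klScale klE0 (n + 1) +
            (393216 / Real.pi * (64 * (klScale klE0 (n + 1) / klScale klE0 j) ^ 2 + (2 * (448 / 3 * Real.exp 2) + 8) + 64) *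
                (2 * A₀ * (Real.pi * Real.sqrt 2 / (d - 4 * A)))) *
              ((Real.pi / β) / klScale klE0 (n + 1)) +
            (256 / Real.pi * 8 * (2 * A₀ * (Real.pi * Real.sqrt 2 / (d - 4 * A))) * (65 * (8 * (16 : ℝ) ^ (j - (n + 1))) + 17408 / 3 * 1)) *
              ((|(0 : ℝ)| + δ) / klScale klE0 (n + 1))) +
        96 * (512 * La / klScale klE0 (n + 1) +
            32 * A₀ * G * ((9 * (2 * (448 / 3 * Real.exp 2) + 8) + 4 * 8) + (65 * (8 * (16 : ℝ) ^ (j - (n + 1))) + 17408 / 3 * 1)) /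
              klScale klE0 (n + 1) ^ 2) / L := by
  have hΛ := (klth_klScale_pos (n + 1)).ne'
  have hΛj := (klth_klScale_pos j).ne'
  have hL : ((L : ℝ)) ≠ 0 := by exact_mod_cast NeZero.ne L
  have hπ : Real.pi ≠ 0 := Real.pi_pos.ne'
  have h4 : klScale klE0 n = 4 * klScale klE0 (n + 1) := by rw [klth_klScale_succ]; ring
  unfold klmsRowBound
  rw [h4]
  field_simp
  ring

/-- **THERMAL DICTIONARY for the row's scale** (this lineage's technique): for `n ≤ n_β` and `klBetaMin ≤ β`, `(π/β)/Λₙ₊₁ ≤ 4·4^{−(n_β − n)}`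
(so `TH₀·(π/β)/Λₙ₊₁` is a `thermalBar`-shaped slot at index `n+1`). -/
theorem klmsRoom_thermal_le {β : ℝ} (hβ : klBetaMin ≤ β) {n : ℕ} (hn : n ≤ nScales β) :
    (Real.pi / β) / klScale klE0 (n + 1) ≤ 4 * ((4 : ℝ) ^ (nScales β - n))⁻¹ := by
  have hΛ := klth_klScale_pos (n + 1)
  have h1 : (Real.pi / β) / klScale klE0 (n + 1) = 4 * ((Real.pi / β) / klScale klE0 n) := by
    rw [klth_klScale_succ]; field_simp
  rw [h1]
  exact mul_le_mul_of_nonneg_left (klth_ratio_le_inv_pow hβ hn) (by norm_num)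

/-- **THE FLAT REMAINDER in the STEP's normalisation** (the arithmetic of `direct_row_flat_le`): for a constant `0 ≤ C ≤ 512/3` and any weight `φ`,
`(Λₙ − Λₙ₊₁)((βL²)³)⁻¹·(ε·(C·(βL²)²/Λ(t)²·Σ_p|φ(p)|‖ĝ_K(p)‖)) ≤ ε·2048·klSoftMass n φ`. -/
theorem klmsRoom_flat_le {L M : ℕ} [NeZero L] {β : ℝ} (hβ : 0 < β) (μ : ℝ) (K : TrigPolyC4v) (n : ℕ) {t : ℝ} (ht : t ∈ Set.Icc (0 : ℝ) 1)
    (φ : FreqMomentum L M → ℝ) {ε C : ℝ} (hε : 0 ≤ ε) (hC : 0 ≤ C) (hC' : C ≤ 512 / 3) :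
    (klScale klE0 n - klScale klE0 (n + 1)) * ((β * (L : ℝ) ^ 2) ^ 3)⁻¹ *
        (ε * (C * (β * (L : ℝ) ^ 2) ^ 2 / (klScale klE0 n + t * (klScale klE0 (n + 1) - klScale klE0 n)) ^ 2 *
          ∑ p : FreqMomentum L M, |φ p| * ‖TwoPointAssembly.propCT L M β μ K p‖)) ≤
      ε * (2048 * klSoftMass L M β μ K n φ) := by
  have hL : (0 : ℝ) < L := by exact_mod_cast Nat.pos_of_ne_zero (NeZero.ne L)
  have hΛ := scaleAt_pos n ht
  rw [softSum_eq_klSoftMass hβ μ K n φ]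
  have hs := klth_klScale_succ n
  have hq : klScale klE0 n / 4 ≤ klScale klE0 n + t * (klScale klE0 (n + 1) - klScale klE0 n) := by
    have := (scaleAt_mem n ht).1; linarith
  have hm := klSoftMass_nonneg β μ K hβ n φ
  have h := flat_row_arith (c := C) hβ hL hΛ (klth_klScale_pos n).le hs hq hC hm
  have e : (klScale klE0 n - klScale klE0 (n + 1)) * ((β * (L : ℝ) ^ 2) ^ 3)⁻¹ *
        (ε * (C * (β * (L : ℝ) ^ 2) ^ 2 / (klScale klE0 n + t * (klScale klE0 (n + 1) - klScale klE0 n)) ^ 2 *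
          (klScale klE0 n * (β * (L : ℝ) ^ 2) * klSoftMass L M β μ K n φ))) =
      ε * ((klScale klE0 n - klScale klE0 (n + 1)) * ((β * (L : ℝ) ^ 2) ^ 3)⁻¹ *
        (C * (β * (L : ℝ) ^ 2) ^ 2 / (klScale klE0 n + t * (klScale klE0 (n + 1) - klScale klE0 n)) ^ 2 *
          (klScale klE0 n * (β * (L : ℝ) ^ 2) * klSoftMass L M β μ K n φ))) := by ring
  rw [e]
  refine mul_le_mul_of_nonneg_left (h.trans ?_) hε
  nlinarith

end Summit.HubbardSuperconductivity.HubbardSuperconductivity.Theorems.KLRegimeSplit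

end
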